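import Mathlib.Combinatorics.SimpleGraph.Clique
import Mathlib.Combinatorics.SimpleGraph.Finite
import Mathlib.Combinatorics.SimpleGraph.Maps
import Literature.Combinatorics.SimpleGraph.LovaszTheta

/-!
# Route RamseyUncertifiable, item `SosUncertainty` (stmt-PneNP-9815): the conditioning certificate
(definition)

The one object this seat posits for the crux
`Summit.PneNP.PneNP.Theses.RamseyUncertifiable.SosUncertainty` (`UP_t`): the value of the **level-`s`
conditioning certificate** of a finite graph `G`,

  `condCert G s = max( α(G), (s − 1) + max_{S stable, |S| = s − 1} ϑ(G[N̄(S)]) )`,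

where `N̄(S) = {v | ∀ a ∈ S, Gᶜ.Adj a v}` is the common non-neighbourhood of `S` (outside `S`) and
`ϑ = Literature.Combinatorics.SimpleGraph.lovaszTheta`. It is the upper bound on Laurent's
`las_s(G)` produced by the natural fixed-level certification strategy "condition the moment vector on
`x_a = 1` for the `s − 1` vertices of a stable set `S`, then use `ϑ` on what is left"
(`las_{t+1}(G) ≤ 1 + max_u las_t(G[N̄ u])`, refuter-cdisprove-stmt-PneNP-9815 Disproof (f), landed in
`RamseyUncertifiableSosUncertaintyConditioning.lean`): `las_s(G) ≤ condCert G s` for `s ≥ 1`. The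
`max` with `α(G)` only matters when `G` has no stable `(s−1)`-set (then the inner maximum is over the
empty family, read as `0`, and `las_s(G) = α(G) < s − 1` by finite convergence); otherwise the second
term already dominates `α(G)`. The theorems about it (`las_s ≤ condCert`, and the uncertainty principle
`condCert G s · condCert Gᶜ s ≥ n^{1/s} − (s − 1)` for EVERY graph — the natural level-`s` certificate
can never exhibit `las_s(G) las_s(Gᶜ) = n^{o(1)}`) live in the proof files. Definition only; no fact is
asserted. [folklore]
-/

noncomputable section

namespace Summit.PneNP.PneNP.Theorems.SosUncertainty

open Literature.Combinatorics.SimpleGraph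

set_option linter.dupNamespace false -- `Summit.PneNP.PneNP.…`: summit = sub-problem name (D-0017)

variable {V : Type*} [Fintype V] [DecidableEq V]

/-- **The level-`s` conditioning certificate** of `G`:
`max (α(G)) ((s − 1) + sup {ϑ(G[N̄(S)]) : S a stable (s − 1)-set})`, with
`N̄(S) = {v | ∀ a ∈ S, Gᶜ.Adj a v}` (common non-neighbours, automatically disjoint from `S`) and the
real supremum of the empty family read as `0` (level `s = 0` is junk, as for `las_0`). [folklore] -/
def condCert (G : SimpleGraph V) [DecidableRel G.Adj] (s : ℕ) : ℝ :=
  max (G.indepNum : ℝ)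
    (((s - 1 : ℕ) : ℝ) + sSup ((fun S : Finset V =>
      lovaszTheta (G.induce {v : V | ∀ a ∈ S, Gᶜ.Adj a v})) '' {S : Finset V | G.IsNIndepSet (s - 1) S}))

/-- Unfolding lemma for `condCert`. [folklore] -/
theorem condCert_def (G : SimpleGraph V) [DecidableRel G.Adj] (s : ℕ) :
    condCert G s = max (G.indepNum : ℝ)
      (((s - 1 : ℕ) : ℝ) + sSup ((fun S : Finset V =>
        lovaszTheta (G.induce {v : V | ∀ a ∈ S, Gᶜ.Adj a v})) '' {S : Finset V | G.IsNIndepSet (s - 1) S})) :=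
  rfl

/-- Vocabulary anchor (registered sub-goal of stmt-PneNP-9815 for this definitions file): the
conditioning certificate dominates the stability number, `α(G) ≤ condCert G s`. [folklore] -/
theorem condCert_anchor :
    ∀ {V : Type} [Fintype V] [DecidableEq V] (G : SimpleGraph V) [DecidableRel G.Adj] (s : ℕ),
      (G.indepNum : ℝ) ≤ condCert G s := by
  intro V _ _ G _ s
  exact le_max_left _ _

end Summit.PneNP.PneNP.Theorems.SosUncertainty

end
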